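import Literature.Computability.AlgebraicComplexity.TensorCoordSubst
import Literature.RepresentationTheory.Semisimple.CommutingActionsInvariantSplitting
import HarnessLib

/-!
# Reynolds splitting and invariant lifting for `SL_m × SL_m × SL_m` on `ℂ[⊗³ℂ^m]`
# (Bürgisser–Ikenmeyer 2017 §5, infrastructure)

The representation-theoretic input of the §5 proofs of Bürgisser–Ikenmeyer, *Fundamental
invariants of orbit closures* (J. Algebra 477 (2017)), for the invariant ring
`O(⊗³ℂ^m)^{SL_m × SL_m × SL_m}` (TeX L1981–2008), in the form the tree's §3 proofs consume it
(`exists_invariant_add_eq_of_mem_sup (isSemisimpleRepresentation_coordRep_comp_toGL …)` in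
`BI17DegreeExponentMonoidProofs`):

* `tensorCoordRepSL ι` — the representation of `SL ι ℂ × SL ι ℂ × SL ι ℂ` on the WHOLE coordinate
  ring `MvPolynomial (ι × ι × ι) ℂ` (restriction of `tensorCoordRep ι ℂ`); its fixed vectors are
  BI's `IsSL3Invariant` polynomials (`isSL3Invariant_iff_forall_tensorCoordRepSL_eq`).
* `isSemisimpleRepresentation_tensorCoordRep_sl_slot₁/₂/₃` — each slot `SL ι ℂ` acts completely
  reducibly on the whole ring (the degree pieces `tensorCoordRepDeg` are completely reducible,
  `TensorCoordSubst.lean`, and generate).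
* **`tensorCoordRepSL_exists_fixed_add_eq_of_mem_sup`** (Reynolds splitting) — an `SL³`-invariant
  element of `A + B`, for `SL³`-stable subspaces `A, B` of the whole ring (not necessarily
  homogeneous: vanishing ideals of `SL³·w`, of `{0}`, …), is a sum of `SL³`-invariants of `A` and
  of `B`; **`tensorCoordRepSL_exists_fixed_sub_mem`** (invariant lifting) — an element invariant
  modulo a stable `A` is congruent mod `A` to an `SL³`-invariant. Both by the three-step iteration
  of `CommutingActionsInvariantSplitting.lean` over the three commuting slot actions — no joint
  (three-block Schur–Weyl) complete reducibility is used (route note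
  `HOME/bip/NOTE-t09g4-TensorReynolds-route.md`, cell `val-lit`, row BI2017-B).

With these, `BI2017_lem_5_1_3` (⊇), `BI2017_thm_5_3` and `BI2017_thm_5_8` become ports of the
§3 files (`BI17DegreeExponentMonoidProofs` §Hilbert/§GroupGenerated/§Boundary). Honest framing:
infrastructure only; VP ≠ VNP is NOT proved.

## References

* [BurgisserIkenmeyer2017] P. Bürgisser, C. Ikenmeyer, *Fundamental invariants of orbit closures*,
  J. Algebra 477 (2017) 390–434, §5 (TeX L1945–2008).
* [MumfordFogartyKirwan1994] D. Mumford, J. Fogarty, F. Kirwan, *Geometric Invariant Theory*,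
  Ch. 1 §1 (linear reductivity, the Reynolds operator).
-/

noncomputable section

open MvPolynomial
open scoped Matrix

namespace Literature.Computability.AlgebraicComplexity

open Literature.RepresentationTheory.Semisimple
open Literature.NumberTheory.DiophantineGeometry (isSemisimpleRepresentation_of_subrepresentations)

variable (ι : Type*) [Fintype ι] [DecidableEq ι]

/-- **The representation of `SL ι ℂ × SL ι ℂ × SL ι ℂ` on `ℂ[⊗³ℂ^ι]`** (the whole coordinate ring),
`(g₁,g₂,g₃) ↦ (F ↦ F ∘ (g₁ᵀ ⊗ g₂ᵀ ⊗ g₃ᵀ))`: the restriction of `tensorCoordRep ι ℂ` along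
`SL³ → GL³`. Its invariants are BI's `O(⊗³ℂ^m)^{SL_m^3}`. Plumbing definition. [folklore] -/
def tensorCoordRepSL :
    Representation ℂ (Matrix.SpecialLinearGroup ι ℂ × Matrix.SpecialLinearGroup ι ℂ ×
      Matrix.SpecialLinearGroup ι ℂ) (MvPolynomial (ι × ι × ι) ℂ) :=
  (tensorCoordRep ι ℂ).comp (MonoidHom.prodMap Matrix.SpecialLinearGroup.toGL
    (MonoidHom.prodMap Matrix.SpecialLinearGroup.toGL Matrix.SpecialLinearGroup.toGL))

variable {ι}

/-- Unfolding `tensorCoordRepSL`. [cite: BurgisserIkenmeyer2017, §5 (the action of SL_m^3 on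
O(⊗³ℂ^m), TeX L1981)] -/
theorem tensorCoordRepSL_apply
    (g : Matrix.SpecialLinearGroup ι ℂ × Matrix.SpecialLinearGroup ι ℂ × Matrix.SpecialLinearGroup ι ℂ)
    (F : MvPolynomial (ι × ι × ι) ℂ) :
    tensorCoordRepSL ι g F = tensorCoordSubst ((g.1 : Matrix ι ι ℂ)ᵀ) ((g.2.1 : Matrix ι ι ℂ)ᵀ)
      ((g.2.2 : Matrix ι ι ℂ)ᵀ) F := rfl

/-- **The `SL³`-fixed vectors of `tensorCoordRepSL` are exactly BI's `SL_m^3`-invariants.**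
[cite: BurgisserIkenmeyer2017, §5 (the invariant ring O(⊗³ℂ^m)^{SL_m^3}, TeX L1981)] -/
theorem isSL3Invariant_iff_forall_tensorCoordRepSL_eq (F : MvPolynomial (ι × ι × ι) ℂ) :
    IsSL3Invariant F ↔ ∀ g : Matrix.SpecialLinearGroup ι ℂ × Matrix.SpecialLinearGroup ι ℂ ×
      Matrix.SpecialLinearGroup ι ℂ, tensorCoordRepSL ι g F = F := by
  rw [isSL3Invariant_iff_forall_tensorCoordSubst_eq]
  constructor
  · intro h g
    rw [tensorCoordRepSL_apply]
    have := h g.1.transpose g.2.1.transpose g.2.2.transpose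
    simpa only [Matrix.SpecialLinearGroup.coe_transpose] using this
  · intro h g₁ g₂ g₃
    have := h (g₁.transpose, g₂.transpose, g₃.transpose)
    rw [tensorCoordRepSL_apply] at this
    simpa only [Matrix.SpecialLinearGroup.coe_transpose, Matrix.transpose_transpose] using this

/-! ### The three slot actions on the whole ring -/

/-- The three slot elements generate: `(g₁,g₂,g₃) = (g₁,1,1)(1,g₂,1)(1,1,g₃)`. [folklore] -/
private theorem prod_slots
    (g : Matrix.SpecialLinearGroup ι ℂ × Matrix.SpecialLinearGroup ι ℂ × Matrix.SpecialLinearGroup ι ℂ) :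
    g = (g.1, 1, 1) * (1, g.2.1, 1) * (1, 1, g.2.2) := by
  ext1 <;> [skip; ext1] <;> simp only [Prod.fst_mul, Prod.snd_mul, mul_one, one_mul]

/-- Slot 1 of `tensorCoordRepSL` is the slot-1 restriction of `tensorCoordRep`. [folklore] -/
private theorem tensorCoordRepSL_slot₁ (g : Matrix.SpecialLinearGroup ι ℂ) :
    tensorCoordRepSL ι (g, 1, 1) = ((tensorCoordRep ι ℂ).comp
      ((MonoidHom.inl (GL ι ℂ) (GL ι ℂ × GL ι ℂ)).comp Matrix.SpecialLinearGroup.toGL)) g := by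
  simp only [tensorCoordRepSL, MonoidHom.coe_comp, Function.comp_apply, MonoidHom.coe_prodMap,
    Prod.map_apply', Prod.fst_one, Prod.snd_one, map_one, MonoidHom.inl_apply, Prod.mk_one_one]

/-- Slot 2 of `tensorCoordRepSL`. [folklore] -/
private theorem tensorCoordRepSL_slot₂ (g : Matrix.SpecialLinearGroup ι ℂ) :
    tensorCoordRepSL ι (1, g, 1) = ((tensorCoordRep ι ℂ).comp
      (((MonoidHom.inr (GL ι ℂ) (GL ι ℂ × GL ι ℂ)).comp (MonoidHom.inl (GL ι ℂ) (GL ι ℂ))).comp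
        Matrix.SpecialLinearGroup.toGL)) g := by
  simp only [tensorCoordRepSL, MonoidHom.coe_comp, Function.comp_apply, MonoidHom.coe_prodMap,
    Prod.map_apply, map_one, MonoidHom.inl_apply, MonoidHom.inr_apply]

/-- Slot 3 of `tensorCoordRepSL`. [folklore] -/
private theorem tensorCoordRepSL_slot₃ (g : Matrix.SpecialLinearGroup ι ℂ) :
    tensorCoordRepSL ι (1, 1, g) = ((tensorCoordRep ι ℂ).comp
      (((MonoidHom.inr (GL ι ℂ) (GL ι ℂ × GL ι ℂ)).comp (MonoidHom.inr (GL ι ℂ) (GL ι ℂ))).comp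
        Matrix.SpecialLinearGroup.toGL)) g := by
  simp only [tensorCoordRepSL, MonoidHom.coe_comp, Function.comp_apply, MonoidHom.coe_prodMap,
    Prod.map_apply, map_one, MonoidHom.inr_apply]

/-- A representation restricted along a group homomorphism into `GL³` is completely reducible on
the whole ring `ℂ[⊗³]` as soon as it is on every degree piece (the pieces are stable and
generate). [folklore] -/
private theorem isSemisimpleRepresentation_comp_of_deg {H : Type*} [Group H]
    (f : H →* GL ι ℂ × GL ι ℂ × GL ι ℂ)
    (hdeg : ∀ d : ℕ, Representation.IsSemisimpleRepresentation (k := ℂ) (G := H)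
      ((tensorCoordRepDeg ι ℂ d).toRepresentation.comp f)) :
    Representation.IsSemisimpleRepresentation (k := ℂ) (G := H) ((tensorCoordRep ι ℂ).comp f) := by
  let W : ℕ → Subrepresentation ((tensorCoordRep ι ℂ).comp f) := fun d =>
    { toSubmodule := homogeneousSubmodule (ι × ι × ι) ℂ d
      apply_mem_toSubmodule := fun g _ hF => (tensorCoordRepDeg ι ℂ d).apply_mem_toSubmodule (f g) hF }
  refine isSemisimpleRepresentation_of_subrepresentations {U | ∃ d, U = W d} ?_ ?_
  · rintro U ⟨d, rfl⟩
    exact hdeg d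
  · intro U hU
    apply Subrepresentation.toSubmodule_injective
    rw [show (⊤ : Subrepresentation ((tensorCoordRep ι ℂ).comp f)).toSubmodule = ⊤ from rfl, eq_top_iff]
    rintro F -
    rw [← sum_homogeneousComponent F]
    refine Submodule.sum_mem _ fun n _ => ?_
    exact hU _ ⟨n, rfl⟩ (homogeneousComponent_mem n F)

/-- **Slot 1 of `SL ι ℂ³` acts completely reducibly on the whole ring `ℂ[⊗³ℂ^ι]`** (linear
reductivity of `SL_m` in one tensor factor; degree pieces
`isSemisimpleRepresentation_tensorCoordRepDeg_sl_slot₁` generate).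
[cite: MumfordFogartyKirwan1994, Ch. 1 §1 Def. 1.1 and (b) after it] -/
theorem isSemisimpleRepresentation_tensorCoordRep_sl_slot₁ [Nonempty ι] :
    Representation.IsSemisimpleRepresentation (k := ℂ) (G := Matrix.SpecialLinearGroup ι ℂ)
      ((tensorCoordRep ι ℂ).comp
        ((MonoidHom.inl (GL ι ℂ) (GL ι ℂ × GL ι ℂ)).comp Matrix.SpecialLinearGroup.toGL)) :=
  isSemisimpleRepresentation_comp_of_deg _ isSemisimpleRepresentation_tensorCoordRepDeg_sl_slot₁

/-- **Slot 2 of `SL ι ℂ³` acts completely reducibly on `ℂ[⊗³ℂ^ι]`.**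
[cite: MumfordFogartyKirwan1994, Ch. 1 §1 Def. 1.1 and (b) after it] -/
theorem isSemisimpleRepresentation_tensorCoordRep_sl_slot₂ [Nonempty ι] :
    Representation.IsSemisimpleRepresentation (k := ℂ) (G := Matrix.SpecialLinearGroup ι ℂ)
      ((tensorCoordRep ι ℂ).comp
        (((MonoidHom.inr (GL ι ℂ) (GL ι ℂ × GL ι ℂ)).comp (MonoidHom.inl (GL ι ℂ) (GL ι ℂ))).comp
          Matrix.SpecialLinearGroup.toGL)) :=
  isSemisimpleRepresentation_comp_of_deg _ isSemisimpleRepresentation_tensorCoordRepDeg_sl_slot₂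

/-- **Slot 3 of `SL ι ℂ³` acts completely reducibly on `ℂ[⊗³ℂ^ι]`.**
[cite: MumfordFogartyKirwan1994, Ch. 1 §1 Def. 1.1 and (b) after it] -/
theorem isSemisimpleRepresentation_tensorCoordRep_sl_slot₃ [Nonempty ι] :
    Representation.IsSemisimpleRepresentation (k := ℂ) (G := Matrix.SpecialLinearGroup ι ℂ)
      ((tensorCoordRep ι ℂ).comp
        (((MonoidHom.inr (GL ι ℂ) (GL ι ℂ × GL ι ℂ)).comp (MonoidHom.inr (GL ι ℂ) (GL ι ℂ))).comp
          Matrix.SpecialLinearGroup.toGL)) :=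
  isSemisimpleRepresentation_comp_of_deg _ isSemisimpleRepresentation_tensorCoordRepDeg_sl_slot₃

/-! ### Reynolds splitting and invariant lifting for `SL³` -/

section Reynolds

variable [Nonempty ι]

omit [Nonempty ι] in
/-- Products of distinct slot elements of `GL³` commute. [folklore] -/
private theorem tensorCoordRep_slot_comm (x y : GL ι ℂ × GL ι ℂ × GL ι ℂ) (hxy : x * y = y * x)
    (v : MvPolynomial (ι × ι × ι) ℂ) :
    tensorCoordRep ι ℂ x (tensorCoordRep ι ℂ y v) = tensorCoordRep ι ℂ y (tensorCoordRep ι ℂ x v) := by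
  rw [← Module.End.mul_apply, ← map_mul, hxy, map_mul, Module.End.mul_apply]

/-- **Reynolds splitting for `SL_m^3` on `ℂ[⊗³ℂ^m]`**: for `SL³`-stable subspaces `A`, `B` of the
coordinate ring and an `SL³`-invariant `v ∈ A + B`, there are `SL³`-invariant `a ∈ A`, `b ∈ B`
with `a + b = v` (naturality of the Reynolds operator of the linearly reductive `SL_m^3`; here from
the complete reducibility of the three slot actions and the three-step iteration
`exists_fixed₃_add_eq_of_mem_sup`). [cite: MumfordFogartyKirwan1994, Ch. 1 §1 Def. 1.5] -/
theorem tensorCoordRepSL_exists_fixed_add_eq_of_mem_sup (A B : Subrepresentation (tensorCoordRepSL ι))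
    {v : MvPolynomial (ι × ι × ι) ℂ} (hv : v ∈ A.toSubmodule ⊔ B.toSubmodule)
    (hinv : ∀ g, tensorCoordRepSL ι g v = v) :
    ∃ a ∈ A.toSubmodule, ∃ b ∈ B.toSubmodule,
      (∀ g, tensorCoordRepSL ι g a = a) ∧ (∀ g, tensorCoordRepSL ι g b = b) ∧ a + b = v := by
  have h₁ := isSemisimpleRepresentation_tensorCoordRep_sl_slot₁ (ι := ι)
  have h₂ := isSemisimpleRepresentation_tensorCoordRep_sl_slot₂ (ι := ι)
  have h₃ := isSemisimpleRepresentation_tensorCoordRep_sl_slot₃ (ι := ι)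
  obtain ⟨a, ha, b, hb, ⟨ha₁, ha₂, ha₃⟩, ⟨hb₁, hb₂, hb₃⟩, hab⟩ :=
    exists_fixed₃_add_eq_of_mem_sup h₁ h₂ h₃
      (fun g h w => by
        simp only [MonoidHom.coe_comp, Function.comp_apply]
        exact tensorCoordRep_slot_comm _ _ (by simp only [MonoidHom.inl_apply, MonoidHom.inr_apply,
          Prod.mk_mul_mk, mul_one, one_mul]) w)
      (fun g h w => by
        simp only [MonoidHom.coe_comp, Function.comp_apply]
        exact tensorCoordRep_slot_comm _ _ (by simp only [MonoidHom.inl_apply, MonoidHom.inr_apply,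
          Prod.mk_mul_mk, mul_one, one_mul]) w)
      (fun g h w => by
        simp only [MonoidHom.coe_comp, Function.comp_apply]
        exact tensorCoordRep_slot_comm _ _ (by simp only [MonoidHom.inl_apply, MonoidHom.inr_apply,
          Prod.mk_mul_mk, mul_one, one_mul]) w)
      A.toSubmodule B.toSubmodule
      (fun g w hw => by rw [← tensorCoordRepSL_slot₁]; exact A.apply_mem_toSubmodule _ hw)
      (fun g w hw => by rw [← tensorCoordRepSL_slot₂]; exact A.apply_mem_toSubmodule _ hw)
      (fun g w hw => by rw [← tensorCoordRepSL_slot₃]; exact A.apply_mem_toSubmodule _ hw)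
      (fun g w hw => by rw [← tensorCoordRepSL_slot₁]; exact B.apply_mem_toSubmodule _ hw)
      (fun g w hw => by rw [← tensorCoordRepSL_slot₂]; exact B.apply_mem_toSubmodule _ hw)
      (fun g w hw => by rw [← tensorCoordRepSL_slot₃]; exact B.apply_mem_toSubmodule _ hw)
      hv
      (fun g => by rw [← tensorCoordRepSL_slot₁]; exact hinv _)
      (fun g => by rw [← tensorCoordRepSL_slot₂]; exact hinv _)
      (fun g => by rw [← tensorCoordRepSL_slot₃]; exact hinv _)
  refine ⟨a, ha, b, hb, fun g => ?_, fun g => ?_, hab⟩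
  · rw [prod_slots g, map_mul, map_mul, Module.End.mul_apply, Module.End.mul_apply,
      tensorCoordRepSL_slot₃, ha₃, tensorCoordRepSL_slot₂, ha₂, tensorCoordRepSL_slot₁, ha₁]
  · rw [prod_slots g, map_mul, map_mul, Module.End.mul_apply, Module.End.mul_apply,
      tensorCoordRepSL_slot₃, hb₃, tensorCoordRepSL_slot₂, hb₂, tensorCoordRepSL_slot₁, hb₁]

/-- **Invariant lifting for `SL_m^3` on `ℂ[⊗³ℂ^m]`**: for an `SL³`-stable subspace `A` of the
coordinate ring and `v` invariant modulo `A` (`g·v - v ∈ A` for all `g ∈ SL³`), there is an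
`SL³`-invariant `u` with `v - u ∈ A` (surjectivity of `ℂ[⊗³]^{SL³} → (ℂ[⊗³]/A)^{SL³}`, e.g. onto
`O(Z)^{SL³}` for a stable closed `Z`; via `exists_fixed₃_sub_mem`).
[cite: MumfordFogartyKirwan1994, Ch. 1 §1 Def. 1.5] -/
theorem tensorCoordRepSL_exists_fixed_sub_mem (A : Subrepresentation (tensorCoordRepSL ι))
    {v : MvPolynomial (ι × ι × ι) ℂ} (hv : ∀ g, tensorCoordRepSL ι g v - v ∈ A.toSubmodule) :
    ∃ u : MvPolynomial (ι × ι × ι) ℂ, (∀ g, tensorCoordRepSL ι g u = u) ∧ v - u ∈ A.toSubmodule := by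
  have h₁ := isSemisimpleRepresentation_tensorCoordRep_sl_slot₁ (ι := ι)
  have h₂ := isSemisimpleRepresentation_tensorCoordRep_sl_slot₂ (ι := ι)
  have h₃ := isSemisimpleRepresentation_tensorCoordRep_sl_slot₃ (ι := ι)
  obtain ⟨u, hu₁, hu₂, hu₃, hvu⟩ :=
    exists_fixed₃_sub_mem h₁ h₂ h₃
      (fun g h w => by
        simp only [MonoidHom.coe_comp, Function.comp_apply]
        exact tensorCoordRep_slot_comm _ _ (by simp only [MonoidHom.inl_apply, MonoidHom.inr_apply,
          Prod.mk_mul_mk, mul_one, one_mul]) w)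
      (fun g h w => by
        simp only [MonoidHom.coe_comp, Function.comp_apply]
        exact tensorCoordRep_slot_comm _ _ (by simp only [MonoidHom.inl_apply, MonoidHom.inr_apply,
          Prod.mk_mul_mk, mul_one, one_mul]) w)
      (fun g h w => by
        simp only [MonoidHom.coe_comp, Function.comp_apply]
        exact tensorCoordRep_slot_comm _ _ (by simp only [MonoidHom.inl_apply, MonoidHom.inr_apply,
          Prod.mk_mul_mk, mul_one, one_mul]) w)
      A.toSubmodule
      (fun g w hw => by rw [← tensorCoordRepSL_slot₁]; exact A.apply_mem_toSubmodule _ hw)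
      (fun g w hw => by rw [← tensorCoordRepSL_slot₂]; exact A.apply_mem_toSubmodule _ hw)
      (fun g w hw => by rw [← tensorCoordRepSL_slot₃]; exact A.apply_mem_toSubmodule _ hw)
      (fun g => by rw [← tensorCoordRepSL_slot₁]; exact hv _)
      (fun g => by rw [← tensorCoordRepSL_slot₂]; exact hv _)
      (fun g => by rw [← tensorCoordRepSL_slot₃]; exact hv _)
  refine ⟨u, fun g => ?_, hvu⟩
  rw [prod_slots g, map_mul, map_mul, Module.End.mul_apply, Module.End.mul_apply,
    tensorCoordRepSL_slot₃, hu₃, tensorCoordRepSL_slot₂, hu₂, tensorCoordRepSL_slot₁, hu₁]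

/-- **Reynolds splitting, in BI's vocabulary**: an `IsSL3Invariant` element of `A + B` (`A`, `B`
`SL³`-stable subspaces of `ℂ[⊗³ℂ^m]`) splits into `IsSL3Invariant` summands in `A` and `B`.
[cite: MumfordFogartyKirwan1994, Ch. 1 §1 Def. 1.5] -/
theorem exists_isSL3Invariant_add_eq_of_mem_sup (A B : Subrepresentation (tensorCoordRepSL ι))
    {v : MvPolynomial (ι × ι × ι) ℂ} (hv : v ∈ A.toSubmodule ⊔ B.toSubmodule)
    (hinv : IsSL3Invariant v) :
    ∃ a ∈ A.toSubmodule, ∃ b ∈ B.toSubmodule, IsSL3Invariant a ∧ IsSL3Invariant b ∧ a + b = v := by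
  obtain ⟨a, ha, b, hb, hai, hbi, hab⟩ := tensorCoordRepSL_exists_fixed_add_eq_of_mem_sup A B hv
    ((isSL3Invariant_iff_forall_tensorCoordRepSL_eq v).1 hinv)
  exact ⟨a, ha, b, hb, (isSL3Invariant_iff_forall_tensorCoordRepSL_eq a).2 hai,
    (isSL3Invariant_iff_forall_tensorCoordRepSL_eq b).2 hbi, hab⟩

/-- **Invariant lifting, in BI's vocabulary**: an element of `ℂ[⊗³ℂ^m]` invariant modulo an
`SL³`-stable subspace `A` is congruent mod `A` to an `IsSL3Invariant` polynomial.
[cite: MumfordFogartyKirwan1994, Ch. 1 §1 Def. 1.5] -/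
theorem exists_isSL3Invariant_sub_mem (A : Subrepresentation (tensorCoordRepSL ι))
    {v : MvPolynomial (ι × ι × ι) ℂ} (hv : ∀ g, tensorCoordRepSL ι g v - v ∈ A.toSubmodule) :
    ∃ u : MvPolynomial (ι × ι × ι) ℂ, IsSL3Invariant u ∧ v - u ∈ A.toSubmodule := by
  obtain ⟨u, hu, hvu⟩ := tensorCoordRepSL_exists_fixed_sub_mem A hv
  exact ⟨u, (isSL3Invariant_iff_forall_tensorCoordRepSL_eq u).2 hu, hvu⟩

end Reynolds

end Literature.Computability.AlgebraicComplexity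

end
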